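import Literature.MathematicalPhysics.QuantumFieldTheory.Balaban1983to89.B9Eq380QknitVariationY
import Literature.MathematicalPhysics.QuantumFieldTheory.Balaban1983to89.B9Eq3115KnitCubeLetterY

/-!
# `Balaban1983to89.B9Eq380KnitRowVariationY` — T. Bałaban, *Propagators for lattice gauge theories in a background field*, Commun. Math. Phys. **99** (1985)
# 389–434 [Balaban1985BackgroundPropagators] (3.78)–(3.81) p. 406, with *Averaging operations for lattice gauge theories*, CMP **98** (1985) [Balaban1985Averaging]
# Props. 5–7 pp. 42–43: ★★★ **(3.80)–(3.81) FOR THE COMMON KNIT ROW KERNEL `knitRowY i U Λ p` AT A PAIR `p = (j, c)`** — dag-n06-l's ✓`B9Eq380QknitVariationY`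
# (the member letter `QknitY`, index bonds `ι : IBondY i`) RE-PRESSED ONCE at the pair level of dag-n06-d's ✓`B9Eq3115KnitCubeLetterY.knitRowY`, the plaquette input
# of the retraction DISPLAYED as a hypothesis on the box of `p` — so that BOTH index-bond readings (the member's `QknitY i U Λ ι = knitRowY i U Λ ι.1` and the cube sequence's
# `QknitCubeY i □ U Λ ι = knitRowY i U Λ ι.1`, both `rfl`) inherit it (HAND (s3-b), director-ym №617 (2), dag-n06-d g34)

statement-level skeleton of published theorems with citation tags; proofs where landed; nothing here is a claim about the Yang–Mills mass gap

THE PRINT.  [B9] p. 406: *«Q_j(U′U) = Q_j(U) + F_{2,j}(A), (3.80) … |F_{2,j}(A)A′| ≦ … ≦ O(1)α₁Q″_j|A′| on Λ_j, (3.81) for Mα₀, α₁ sufficiently small and with a constant O(1)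
depending on d and L only.»*; p. 409 l. 1–5 («the operators constructed for this sequence {Ω_n(□)}»); [5] (127) p. 37, (141) p. 39, Prop. 7 p. 43, p. 24 (locality).

WHY THIS FILE.  dag-n06-l proved (3.80)–(3.81) in row form for the member's knit letter at `ι : IBondY i`; every step depends on `ι` only through the pair `ι.1 = (j, c)`
(level, source label `z_c`, direction `κ_c`) EXCEPT ONE: the plaquette smallness on the double block of `ι` (`B9C2FormBoxRegimeY.norm_hol_readY_plaqWord_sub_one_le_of_reg335P`),
which reads the MEMBER's levels at the box's corners (`lev_ends_bounds` for the member's domains).  The cube sequence's knit letter `QknitCubeY i □` (the averaging of the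
(C) Dirichlet bond letter of the N06 heads of record) reads the SAME kernel at the cube sequence's index bonds, whose boxes sit at the cube family's levels.  THIS FILE
re-presses dag-n06-l's §2–§3 at the pair `p`, with that one geometric input DISPLAYED as `hplaq` (every plaquette word of the periodic reading `readY i U` with corner in the
box of `p` is within `K_pl·L⁴·(Lʲ)⁻²` of `1`); the member instance discharges `hplaq` by dag-n06-l's lemma (§4, recovering `norm_QknitY_mulY_sub_apply_le`), the cube
instance (§5) by the cube family's `lev_ends_bounds` (L0) + `lev_cubeFam_le` + this lineage's levelled plaquette reading of (3.35).

WHAT IS DEFINED AND PROVED (sorry-free; `def`s with bodies: `loP`, `hiP`, `retrP`, `boxKP`; theorems).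
* §0 the pair box `loP i p ∕ hiP i p`, the retraction `retrP i U p := retrCfg (loP i p) (hiP i p) (U♯)` (dag-n06-l's `retrY i U ι` is `retrP i U ι.1`, `rfl`), `agreeOn_liftCfg_retrP`,
  `retrP_mem`, `loP_le_hiP`; the box kernel `boxKP i p f` (`boxK i ι = boxKP i ι.1`, `rfl`), `boxKP_nonneg`, `sum_boxKP_mul_eq`.
* §1 ★ `pdev_retrP_lt (hK : K_pl·L⁴ < α₀′) (hplaq) : pdev (retrP i U p) < α₀′·(Lʲ)⁻²` ([5] (52) for the retraction, from the DISPLAYED plaquette input).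
* §2 ★★ `knitRowY_apply_retract (hplaq) : knitRowY i U a p = L^{−j}·(LʲQ_j(Û_p)a♯)(z_c, κ_c)` (dag-n06-l's `QknitY_apply_retract` at the pair).
* §3 `end_block_of_mem_bondsIn_P`, `norm_boxExponentP_le`, ★★ `knitRowY_mulY_apply_retract (hplaq)`, ★★★ `norm_knitRowY_mulY_sub_le (hplaq)` — **(3.80)–(3.81) FOR THE
  KNIT ROW KERNEL AT A PAIR**: `‖knitRowY i (e^{iηa}·U) Λ p − knitRowY i U Λ p‖ ≤ (9∕(2ϱ′))·α₁·Σ_f boxKP i p f·‖Λ f‖` under dag-n06-l's hypotheses verbatim (class (3.35)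
  `bg9KP … Reg335 c₀ α₀`, end-block smallness `Lʲη‖a‖ ≤ α₁`, `3α₁ ≤ ϱ′`, the x-free numerics) PLUS `hplaq`.
* §4 the member face: `hplaq_member`, `norm_QknitY_mulY_sub_apply_le'` — dag-n06-l's theorem RECOVERED from §3 at `p := ι.1` with `hplaq` discharged by
  `norm_hol_readY_plaqWord_sub_one_le_of_reg335P` (a consistency check; nothing new).
* §5 the CUBE-SEQUENCE face: `ends_of_inBox_P`, ★★ `hplaq_cube (ι : IBondCubeY i □)` (corner's cube level `≥ j − 1` by `B6Ineq2142KLevelV1L0.lev_ends_bounds` at `cubeFamY i □`,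
  member level `≥` cube level by `B9CubeSequence408.lev_cubeFam_le`, then `B9Eq335CoveragePAtLettersY.norm_holY_sub_one_le_levelled_of_reg335P` + `scale_slack`), and ★★★
  `norm_QknitCubeY_mulY_sub_apply_le` — **(3.80)–(3.81) FOR `QknitCubeY i □` ON (3.35), ROW FORM** (`QknitCubeY_apply`, `rfl`): the (3.83)-shaped smallness input of the
  knit-pair averaging piece `avgPieceCKnit` (HAND (s3-b)).
HONEST SCOPE.  A re-press BY NAME of dag-n06-l's proofs (`B9Eq380QknitVariationY` §1–§3, `B9Eq3115KnitLetterYOnto.QknitY_apply_retract`, `B9Eq3124HZKnitPairReg335Y.pdev_retract_bond_lt`,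
`B9Eq3115KnitLetterYRowCloseness.boxK ∕ sum_boxK_mul_eq`) with `ι ↦ p`; no new estimate beyond theirs; the crude constant `9∕(2ϱ′)` and every declared reading of the parent
file stand; the `HasMajorant` packaging of §5 for dag-n06-c's `hAv` slot (kernel `boxKP` ⇒ block majorant) is the consumer's∕next file.  COUNT-NEUTRAL (`--supports stmt-QuantumFields-27364`); N06 NOT discharged; K1⁹ NOT
closed; nothing continuum ∕ ℝ⁴ ∕ OS ∕ mass gap ∕ Clay — the Yang–Mills mass gap is NOT proved here.  NEW file; nothing landed is modified.  No `sorry`, no `axiom`, no `instance`,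
no `notation`.  Net new unproved facts: 0.  Seat `pub-ymgap-dag-n06-j` (g39), 2026-08-31.
RELATED, NOT DUPLICATED (searched 2026-08-31: `rg 'retrP|boxKP|knitRowY_apply_retract|norm_knitRowY_mulY_sub_le|KnitRowVariation|hplaq_cube|norm_QknitCubeY_mulY'` over `Literature ∕ Summits` = ∅): the parents above.
-/

noncomputable section

namespace Literature.MathematicalPhysics.QuantumFieldTheory.Balaban1983to89.B9Eq380KnitRowVariationY

open scoped BigOperators
open NormedSpace
open B7Prop1Explicit renaming Site → LSite
open B7Prop1Explicit (e e_apply boxVec U1 Wcx hol plaqWord)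
open B7Prop1Local (InBox AgreeOn loK bondHiK)
open B7Prop5Flat (BondIn bondsIn mem_bondsIn restr agreeOn_insCfg_restr agreeOn_expCfg)
open B7Prop3Flat (insCfg expCfg c3)
open B7Prop2Explicit (pdev avgIter avgClosed_unitaryUnits unitaryUnits unitaryUnits_le_U1 C0 c2')
open B7Prop4GeneralLevels (linCovIter)
open B7Prop4LinCovIterClosed (linCovIterC linCovIterC_eq_linCovIter linCovIterC_eq_linCovIter_of_prop2)
open B7Prop4LinCovIterClosedLaws (linCovIterC_congr)
open B7Prop7Levels (level_loops_lt_one)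
open B7Prop7Ins (smallness7_mono)
open B7Prop5CplxLevels (epsCplx tauCplx avgIter_cplx_eq)
open B7Prop5Cplx (thetaCplx thetaCplx_nonneg)
open B7Prop7LinearKernelBackgroundModulus (norm_linCovIter_sub_base_le_sum)
open B7Eq52RetractionExtension (retrCfg retrCfg_eq_of_bondIn retrCfg_mem pdev_retrCfg_lt)
open B10Eq27TorusAxialLog (transl transl_apply transl_add_e)
open B4Reflection242 (blk)
open B5Eq118OneStroke (iterBlockOf)
open B6GlobalChartV1 (PV)
open B6KLevelCensusIndexV1 (KIdx kGeo)
open B9B8CarrierDictionary (liftCfg liftCfg_apply liftCfg_mem)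
open B9B8KnitBondTransfer (liftBd liftBd_apply)
open B9Eq3115KnitLetterY (zSrc QknitY QknitY_apply)
open B9Eq3115KnitCubeLetterY (zSrcP knitRowY transl_zero_zSrcP QknitY_apply_eq_knitRowY)
open B9Eq3115KnitLetterYFarFace (iterBlockOf_transl_zero blk_of_inBox_bond)
open B9Eq3115KnitLetterYOnto (retrY)
open B9Eq3115KnitLetterYRowCloseness (boxK)
open B9Eq3124HZKnitPairReg335Y (liftCfg_eq_readY)
open B9C2LettersTorusY (readY)
open B9C2FormBoxRegimeY (Kpl Kpl_nonneg norm_hol_readY_plaqWord_sub_one_le_of_reg335P)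
open B9BackgroundsKLevelV1P (bg9KP mem_of_reg335P)
open B9Eq39Adjoint (fluct)
open B9Eq380QknitVariationY (liftCfg_mulY_fluct thetaCplx_rescale epsCplx_tauCplx_rescale thetaCplx_le_half)
open Node00

variable {d ℓ : ℕ} {hd : 1 ≤ d + 1} {hL : Odd (ℓ + 1) ∧ 1 < ℓ + 1} {b₀ b₁ : ℝ}

/-! ## §0 The box, the retraction and the box kernel at a pair `p = (j, c)` -/

section Pair

variable {𝔸 : Type} [NormedRing 𝔸] [NormedAlgebra ℂ 𝔸] [CompleteSpace 𝔸]
variable (i : KIdx d ℓ hd hL b₀ b₁)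

/-- the lower corner `Lʲz_c` of the double box of the pair `p = (j, c)`. [cite: Balaban1985Averaging, p.24 (after (43)), dictionary] -/
abbrev loP (p : (j : Fin (i.k + 1)) × PBond (PV d ℓ i.m i.K hd hL) (j : ℕ)) : LSite (d + 1) := loK (ℓ + 1) (p.1 : ℕ) (zSrcP i p)

/-- the upper corner `Lʲz_c + (Lʲ − 1)𝟙 + Lʲe_κ` of the double box of `p`. [cite: Balaban1985Averaging, p.24 (after (43)), dictionary] -/
abbrev hiP (p : (j : Fin (i.k + 1)) × PBond (PV d ℓ i.m i.K hd hL) (j : ℕ)) : LSite (d + 1) := bondHiK (ℓ + 1) (p.1 : ℕ) (zSrcP i p) p.2.dir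

/-- `loP`, unfolded (`rfl`). [cite: Balaban1985Averaging, p.24, bookkeeping] -/
theorem loP_eq (p : (j : Fin (i.k + 1)) × PBond (PV d ℓ i.m i.K hd hL) (j : ℕ)) : loP i p = loK (ℓ + 1) (p.1 : ℕ) (zSrcP i p) := rfl

/-- `hiP`, unfolded (`rfl`). [cite: Balaban1985Averaging, p.24, bookkeeping] -/
theorem hiP_eq (p : (j : Fin (i.k + 1)) × PBond (PV d ℓ i.m i.K hd hL) (j : ℕ)) : hiP i p = bondHiK (ℓ + 1) (p.1 : ℕ) (zSrcP i p) p.2.dir := rfl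

/-- the box has `lo ≤ hi` coordinatewise. [cite: Balaban1985Averaging, p.24, bookkeeping] -/
theorem loP_le_hiP (p : (j : Fin (i.k + 1)) × PBond (PV d ℓ i.m i.K hd hL) (j : ℕ)) (μ : Fin (d + 1)) : loP i p μ ≤ hiP i p μ := by
  simp only [loK, bondHiK]
  have : (1 : ℤ) ≤ ((ℓ : ℤ) + 1) ^ (p.1 : ℕ) := one_le_pow₀ (by linarith)
  split_ifs <;> push_cast <;> nlinarith

/-- ★ **THE RETRACTION OF THE LIFTED BACKGROUND TO THE DOUBLE BOX OF A PAIR** `Û_p := retrCfg (loP p) (hiP p) (U♯)` (dag-n06-l's `retrY i U ι` at `p = ι.1`).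
[cite: Balaban1985Averaging, (52) p.26, p.24 (locality); Balaban1985BackgroundPropagators, (3.35) p.396] -/
def retrP (U : CfgY 𝔸 i) (p : (j : Fin (i.k + 1)) × PBond (PV d ℓ i.m i.K hd hL) (j : ℕ)) : LSite (d + 1) → Fin (d + 1) → 𝔸ˣ :=
  retrCfg (loP i p) (hiP i p) (liftCfg U)

/-- dag-n06-l's retraction IS the pair retraction at `ι.1` (`rfl`). [cite: Balaban1985Averaging, (52) p.26, bookkeeping] -/
theorem retrY_eq_retrP (U : CfgY 𝔸 i) (ι : IBondY i) : retrY i U ι = retrP i U ι.1 := rfl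

/-- `Û_p` AGREES with `U♯` on the box of `p`. [cite: Balaban1985Averaging, p.24 (locality), bookkeeping] -/
theorem agreeOn_liftCfg_retrP (U : CfgY 𝔸 i) (p : (j : Fin (i.k + 1)) × PBond (PV d ℓ i.m i.K hd hL) (j : ℕ)) :
    AgreeOn (loP i p) (hiP i p) (liftCfg U) (retrP i U p) :=
  fun _ _ hx hxe => (retrCfg_eq_of_bondIn (liftCfg U) ⟨hx, hxe⟩).symm

/-- `Û_p` is `G`-valued when `U` is. [cite: Balaban1985Averaging, p.26, bookkeeping] -/
theorem retrP_mem {G : Subgroup 𝔸ˣ} {U : CfgY 𝔸 i} (hU : ∀ μ x, U μ x ∈ G) (p : (j : Fin (i.k + 1)) × PBond (PV d ℓ i.m i.K hd hL) (j : ℕ))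
    (x : LSite (d + 1)) (μ : Fin (d + 1)) : retrP i U p x μ ∈ G :=
  retrCfg_mem (fun x μ => liftCfg_mem hU x μ) x μ

/-- **THE BOX KERNEL AT A PAIR** `boxKP p f = (Lʲ)^{−(d+1)}·#{s ⊂ box(p) : s♭ = f}` (dag-n06-l's `boxK i ι` at `p = ι.1`; print's `Q″_j`, [5] (141)).
[cite: Balaban1985Averaging, (139)–(147) pp.39–40, p.24; Balaban1985BackgroundPropagators, (3.81) p.406] -/
def boxKP (p : (j : Fin (i.k + 1)) × PBond (PV d ℓ i.m i.K hd hL) (j : ℕ)) (f : FBondY i) : ℝ :=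
  (((((ℓ + 1 : ℕ) : ℝ)) ^ (p.1 : ℕ)) ^ (d + 1))⁻¹ *
    (((bondsIn (loP i p) (hiP i p)).filter fun s => (⟨transl (0 : Site (PV d ℓ i.m i.K hd hL) 0) s.1, s.2⟩ : FBondY i) = f).card : ℝ)

/-- dag-n06-l's box kernel IS the pair kernel at `ι.1` (`rfl`). [cite: Balaban1985Averaging, (141) p.39, bookkeeping] -/
theorem boxK_eq_boxKP (ι : IBondY i) (f : FBondY i) : boxK i ι f = boxKP i ι.1 f := rfl

/-- the box kernel is nonnegative. [cite: Balaban1985Averaging, (139) p.39, bookkeeping] -/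
theorem boxKP_nonneg (p : (j : Fin (i.k + 1)) × PBond (PV d ℓ i.m i.K hd hL) (j : ℕ)) (f : FBondY i) : 0 ≤ boxKP i p f := by
  unfold boxKP; positivity

/-- ★ **FIBREWISE READING**: `Σ_f boxKP p f·g(f) = (Lʲ)^{−(d+1)}·Σ_{s ⊂ box(p)} g(s♭)`. [cite: Balaban1985Averaging, (139)–(147) pp.39–40, bookkeeping] -/
theorem sum_boxKP_mul_eq (p : (j : Fin (i.k + 1)) × PBond (PV d ℓ i.m i.K hd hL) (j : ℕ)) (g : FBondY i → ℝ) :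
    ∑ f, boxKP i p f * g f = (((((ℓ + 1 : ℕ) : ℝ)) ^ (p.1 : ℕ)) ^ (d + 1))⁻¹ *
      ∑ s ∈ bondsIn (loP i p) (hiP i p), g ⟨transl (0 : Site (PV d ℓ i.m i.K hd hL) 0) s.1, s.2⟩ := by
  classical
  set S := bondsIn (loP i p) (hiP i p) with hS
  set φ : LSite (d + 1) × Fin (d + 1) → FBondY i := fun s => ⟨transl (0 : Site (PV d ℓ i.m i.K hd hL) 0) s.1, s.2⟩ with hφ
  have hfib : ∑ s ∈ S, g (φ s) = ∑ f, ∑ s ∈ S with φ s = f, g (φ s) := (Finset.sum_fiberwise S φ fun s => g (φ s)).symm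
  simp only [boxKP, mul_assoc, ← Finset.mul_sum]
  congr 1
  rw [hfib]
  refine Finset.sum_congr rfl fun f _ => ?_
  rw [Finset.sum_congr rfl fun s hs => by rw [(Finset.mem_filter.1 hs).2], Finset.sum_const, nsmul_eq_mul]

/-- **A BOX BOND's SOURCE LIES IN AN END BLOCK OF `p`**: for `(x, μ)` a bond of the double box of `p` (level `j`), the `j`-block of the torus site under `x` is `c₋` or `c₊`.
[cite: Balaban1985Averaging, p.24; Balaban1984PropagatorsII, (2.3) p.224] -/
theorem end_block_of_mem_bondsIn_P (p : (j : Fin (i.k + 1)) × PBond (PV d ℓ i.m i.K hd hL) (j : ℕ)) {s : LSite (d + 1) × Fin (d + 1)}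
    (hs : s ∈ bondsIn (loP i p) (hiP i p)) :
    iterBlockOf (p.1 : ℕ) (transl (0 : Site (PV d ℓ i.m i.K hd hL) 0) s.1) = p.2.src ∨
      iterBlockOf (p.1 : ℕ) (transl (0 : Site (PV d ℓ i.m i.K hd hL) 0) s.1) = p.2.tgt := by
  have hj : (p.1 : ℕ) ≤ i.m + i.K := (Nat.le_of_lt_succ p.1.2).trans i.hk
  have hx := (mem_bondsIn.1 hs).1
  rw [iterBlockOf_transl_zero i hj]
  rcases blk_of_inBox_bond hx with hb | hb
  · left; rw [hb, transl_zero_zSrcP]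
  · right; rw [hb, transl_add_e, transl_zero_zSrcP]; rfl

end Pair

/-! ## §1–§3 On (3.35) with the plaquette input of the box DISPLAYED: the retraction's (52), the ungated row, and (3.80)–(3.81) in row form -/

section Main

open scoped Matrix Matrix.Norms.L2Operator

variable {N : ℕ} [Nonempty (Fin N)] (i : KIdx d ℓ hd hL b₀ b₁) {G : Subgroup (Matrix (Fin N) (Fin N) ℂ)ˣ}
  (hGU : G ≤ unitaryUnits (Matrix (Fin N) (Fin N) ℂ))
  {U : CfgY (Matrix (Fin N) (Fin N) ℂ) i} {c₀ α₀ : ℝ} (hMα : 0 ≤ (kGeo i).M * α₀)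
  (hreg : (bg9KP (Matrix (Fin N) (Fin N) ℂ) G i).Reg335 c₀ α₀ U)
  -- the x-free numerics of the (3.35) ⟹ (52) bridge at the retraction
  {α₀' : ℝ} (hα' : 0 < α₀') (hα3 : C0 (d + 1) * α₀' ≤ 1 / 3) (hα8 : 8 * α₀' ≤ c2' (d + 1) (ℓ + 1))
  (hK : Kpl i ((kGeo i).M * α₀) * (kGeo i).L ^ 4 < α₀')
  -- r04∕p06's Prop-7∕Prop-5 window at the radii `ϱ′` (background) and `ϱ` (field), in COARSE units (`Lʲρ′ = ϱ′`)
  {ϱ' ϱ : ℝ} (hϱ' : 0 < ϱ') (hϱ : 0 < ϱ)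
  (hsmall' : Real.exp (4 * (800 * (((d + 1 : ℕ) : ℝ) + 1) ^ 2 * (((d + 1 : ℕ) : ℝ) + 4)) * α₀')
    * (1 + 8 * (131072 * (((d + 1 : ℕ) : ℝ) + 1) ^ 2) * ϱ') ≤ 2)
  (hc₃' : 2 * ϱ' ≤ c3 (d + 1) (ℓ + 1)) (hϱ'1 : 409600 * (((d + 1 : ℕ) : ℝ) + 1) ^ 2 * ϱ' ≤ 1)
  (hE : epsCplx (d + 1) (ℓ + 1) ϱ' 0 ≤ 1 / 16)
  (hdX : ((d + 1 : ℕ) : ℝ) * (epsCplx (d + 1) (ℓ + 1) ϱ' 0 + tauCplx (d + 1) (ℓ + 1) α₀' 0 ϱ' 0) ≤ 1 / 16)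
  (hsmall : Real.exp (4480 * (((d + 1 : ℕ) : ℝ) + 1) ^ 2 * (((d + 1 : ℕ) : ℝ) + 4) * α₀' + 240000 * (((d + 1 : ℕ) : ℝ) + 1) ^ 3 * ϱ')
    * (1 + 8 * (2097152 * (((d + 1 : ℕ) : ℝ) + 1) ^ 2) * ϱ) ≤ 2)
  (hc₃ : 2 * ϱ ≤ c3 (d + 1) (ℓ + 1) / 4)
  -- the pair, and the DISPLAYED plaquette input of its box
  (p : (j : Fin (i.k + 1)) × PBond (PV d ℓ i.m i.K hd hL) (j : ℕ))
  (hplaq : ∀ (y : LSite (d + 1)), InBox (loP i p) (hiP i p) y → ∀ μ ν : Fin (d + 1),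
    ‖((hol (readY i U) y (plaqWord μ ν) : (Matrix (Fin N) (Fin N) ℂ)ˣ) : Matrix (Fin N) (Fin N) ℂ) - 1‖ ≤
      Kpl i ((kGeo i).M * α₀) * ((kGeo i).L ^ 4 * ((((kGeo i).L ^ (p.1 : ℕ))⁻¹) ^ 2)))
  -- the perturbation: print's (3.37) smallness on the two end blocks of `p`
  (a : Fin (d + 1) → Site (PV d ℓ i.m i.K hd hL) 0 → Matrix (Fin N) (Fin N) ℂ) {α₁ : ℝ} (hα₁ : 0 ≤ α₁) (hα₁ϱ : 3 * α₁ ≤ ϱ')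
  (ha : ∀ (μ : Fin (d + 1)) (x : Site (PV d ℓ i.m i.K hd hL) 0),
    iterBlockOf (p.1 : ℕ) x = p.2.src ∨ iterBlockOf (p.1 : ℕ) x = p.2.tgt →
      (((ℓ + 1 : ℕ) : ℝ)) ^ (p.1 : ℕ) * (kGeo i).eta * ‖a μ x‖ ≤ α₁)

omit [Nonempty (Fin N)] in
include hMα hK hplaq in
/-- ★ **THE RETRACTION OF `U♯` TO THE DOUBLE BOX OF THE PAIR SATISFIES [5]'s GLOBAL (52) AT SCALE `j`** from the DISPLAYED plaquette input of the box:
`pdev Û_p < α₀′·(Lʲ)⁻²` whenever `K_pl·L⁴ < α₀′` (dag-n06-l's `pdev_retract_bond_lt` with its geometric step made a hypothesis).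
[cite: Balaban1985Averaging, (52) p.26, Prop. 2 p.26 (locality sentence); Balaban1985BackgroundPropagators, (3.35) p.396] -/
theorem pdev_retrP_lt : pdev (retrP i U p) < α₀' * ((((ℓ + 1 : ℕ) : ℝ) ^ (p.1 : ℕ))⁻¹) ^ 2 := by
  have hK0 : 0 ≤ Kpl i ((kGeo i).M * α₀) := Kpl_nonneg i hMα
  have hLe : (kGeo i).L = ((ℓ + 1 : ℕ) : ℝ) := rfl
  have hpos : (0 : ℝ) < ((((ℓ + 1 : ℕ) : ℝ) ^ (p.1 : ℕ))⁻¹) ^ 2 := by positivity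
  refine pdev_retrCfg_lt (loP_le_hiP i p) (liftCfg U) (M := Kpl i ((kGeo i).M * α₀) * ((kGeo i).L ^ 4 * ((((kGeo i).L ^ (p.1 : ℕ))⁻¹) ^ 2)))
    (by rw [hLe]; positivity) ?_ (fun y μ ν _ hy _ _ => ?_)
  · rw [hLe, ← mul_assoc]
    exact mul_lt_mul_of_pos_right hK hpos
  · rw [liftCfg_eq_readY]
    exact hplaq y hy μ ν

include hGU hMα hreg hα' hα3 hα8 hK hplaq in
/-- ★★ **THE ROW KERNEL THROUGH THE RETRACTION, UNGATED**: `knitRowY i U a p = L^{−j}·(LʲQ_j(Û_p)a♯)(z_c, κ_c)` — locality of the gated composite moves `U♯` to `Û_p`; [5] Prop. 2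
for `Û_p` (§1) opens every gate (dag-n06-l's `QknitY_apply_retract` at the pair). [cite: Balaban1985BackgroundPropagators, (3.12)–(3.15) p.393, (3.35) p.396; Balaban1985Averaging, Prop. 2 p.26, p.24] -/
theorem knitRowY_apply_retract (a : FBondY i → Matrix (Fin N) (Fin N) ℂ) :
    knitRowY i U a p = (((((ℓ + 1 : ℕ) : ℝ) ^ (p.1 : ℕ))⁻¹ : ℝ) : ℂ) • linCovIter (ℓ + 1) (retrP i U p) (liftBd i a) (p.1 : ℕ) (zSrcP i p) p.2.dir := by
  letI : CStarAlgebra (Matrix (Fin N) (Fin N) ℂ) := {}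
  have hL1 : 1 ≤ ℓ + 1 := Nat.succ_pos ℓ
  have hL2 : 2 ≤ ℓ + 1 := hL.2
  have hα2 : 2 * α₀' ≤ c2' (d + 1) (ℓ + 1) := by linarith
  have hU : ∀ μ x, U μ x ∈ unitaryUnits (Matrix (Fin N) (Fin N) ℂ) := fun μ x => hGU (mem_of_reg335P (G := G) i hreg μ x)
  have hVu : ∀ x μ, retrP i U p x μ ∈ unitaryUnits (Matrix (Fin N) (Fin N) ℂ) := retrP_mem i hU p
  have h52 : pdev (retrP i U p) < α₀' * ((((ℓ + 1 : ℕ) : ℝ) ^ (p.1 : ℕ))⁻¹) ^ 2 := pdev_retrP_lt i hMα hK p hplaq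
  have hung := linCovIterC_eq_linCovIter_of_prop2 (ℓ + 1) (retrP i U p) hL2 (avgClosed_unitaryUnits (d + 1) (ℓ + 1)) (p.1 : ℕ) hVu hα' hα3 hα2 h52
    (liftBd i a) (p.1 : ℕ) le_rfl
  rw [knitRowY, linCovIterC_congr (ℓ + 1) hL1 (p.1 : ℕ) (zSrcP i p) p.2.dir (agreeOn_liftCfg_retrP i U p) (fun _ _ _ _ => rfl), hung]

omit [Nonempty (Fin N)] in
include hα₁ ha in
/-- the lifted exponent `a♯(s) = iη·a(s♭)` restricted to the box of `p` is bounded by `α₁·L^{−j}` everywhere. [cite: Balaban1985BackgroundPropagators, (3.37) p.396, (3.81) p.406, bookkeeping] -/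
theorem norm_boxExponentP_le :
    ∀ (x : LSite (d + 1)) (κ : Fin (d + 1)),
      ‖insCfg (bondsIn (loP i p) (hiP i p)) (restr (bondsIn (loP i p) (hiP i p))
            (fun z μ => ((Complex.I * ((kGeo i).eta : ℝ) : ℂ)) • a μ (transl (0 : Site (PV d ℓ i.m i.K hd hL) 0) z))) x κ‖ ≤
        α₁ * ((((ℓ + 1 : ℕ) : ℝ)) ^ (p.1 : ℕ))⁻¹ := by
  classical
  intro x κ
  have hLj : (0 : ℝ) < (((ℓ + 1 : ℕ) : ℝ)) ^ (p.1 : ℕ) := by positivity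
  have hη : 0 ≤ (kGeo i).eta := by show 0 ≤ |i.cf|⁻¹; positivity
  by_cases hmem : (x, κ) ∈ bondsIn (loP i p) (hiP i p)
  · have hval : insCfg (bondsIn (loP i p) (hiP i p)) (restr (bondsIn (loP i p) (hiP i p))
            (fun z μ => ((Complex.I * ((kGeo i).eta : ℝ) : ℂ)) • a μ (transl (0 : Site (PV d ℓ i.m i.K hd hL) 0) z))) x κ =
        ((Complex.I * ((kGeo i).eta : ℝ) : ℂ)) • a κ (transl (0 : Site (PV d ℓ i.m i.K hd hL) 0) x) := by
      simp [insCfg, restr, hmem]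
    rw [hval, norm_smul, norm_mul, Complex.norm_I, one_mul, Complex.norm_real, Real.norm_of_nonneg hη]
    have hb := ha κ (transl (0 : Site (PV d ℓ i.m i.K hd hL) 0) x) (end_block_of_mem_bondsIn_P i p hmem)
    rw [le_mul_inv_iff₀ hLj]
    calc (kGeo i).eta * ‖a κ (transl 0 x)‖ * (((ℓ + 1 : ℕ) : ℝ)) ^ (p.1 : ℕ)
        = (((ℓ + 1 : ℕ) : ℝ)) ^ (p.1 : ℕ) * (kGeo i).eta * ‖a κ (transl 0 x)‖ := by ring
      _ ≤ α₁ := hb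
  · have hval : insCfg (bondsIn (loP i p) (hiP i p)) (restr (bondsIn (loP i p) (hiP i p))
            (fun z μ => ((Complex.I * ((kGeo i).eta : ℝ) : ℂ)) • a μ (transl (0 : Site (PV d ℓ i.m i.K hd hL) 0) z))) x κ = 0 := by
      simp [insCfg, hmem]
    rw [hval, norm_zero]; positivity

include hGU hMα hreg hα' hα3 hα8 hK hplaq hα₁ ha in
/-- ★★ **THE PERTURBED ROW THROUGH THE RETRACTION, UNGATED**: `knitRowY i (e^{iηa}U) Λ p = L^{−j}·(LʲQ_j(e^{a♭}·Û_p)Λ♯)(z_c, κ_c)` with `a♭` the restriction of `a♯ = iη·a(·♭)` to the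
bonds of the double box (dag-n06-l's `QknitY_mulY_apply_retract` at the pair). [cite: Balaban1985BackgroundPropagators, (3.78) p.406, (3.12)–(3.15) p.393, (3.35) p.396; Balaban1985Averaging, Proposition 7 p.43, p.24] -/
theorem knitRowY_mulY_apply_retract
    (hsmall'p : Real.exp (4 * (800 * (((d + 1 : ℕ) : ℝ) + 1) ^ 2 * (((d + 1 : ℕ) : ℝ) + 4)) * α₀')
      * (1 + 8 * (131072 * (((d + 1 : ℕ) : ℝ) + 1) ^ 2) * ((((ℓ + 1 : ℕ) : ℝ)) ^ (p.1 : ℕ) * (α₁ * ((((ℓ + 1 : ℕ) : ℝ)) ^ (p.1 : ℕ))⁻¹))) ≤ 2)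
    (hc₃'p : 2 * ((((ℓ + 1 : ℕ) : ℝ)) ^ (p.1 : ℕ) * (α₁ * ((((ℓ + 1 : ℕ) : ℝ)) ^ (p.1 : ℕ))⁻¹)) ≤ c3 (d + 1) (ℓ + 1))
    (hb'1p : 409600 * (((d + 1 : ℕ) : ℝ) + 1) ^ 2 * ((((ℓ + 1 : ℕ) : ℝ)) ^ (p.1 : ℕ) * (α₁ * ((((ℓ + 1 : ℕ) : ℝ)) ^ (p.1 : ℕ))⁻¹)) ≤ 1)
    (Λ : FBondY i → Matrix (Fin N) (Fin N) ℂ) :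
    knitRowY i (fun μ x => fluct (kGeo i).eta a μ x * U μ x) Λ p =
      (((((ℓ + 1 : ℕ) : ℝ) ^ (p.1 : ℕ))⁻¹ : ℝ) : ℂ) •
        linCovIter (ℓ + 1)
          (expCfg (insCfg (bondsIn (loP i p) (hiP i p)) (restr (bondsIn (loP i p) (hiP i p))
                (fun z μ => ((Complex.I * ((kGeo i).eta : ℝ) : ℂ)) • a μ (transl (0 : Site (PV d ℓ i.m i.K hd hL) 0) z)))) * retrP i U p)
          (liftBd i Λ) (p.1 : ℕ) (zSrcP i p) p.2.dir := by
  classical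
  letI : CStarAlgebra (Matrix (Fin N) (Fin N) ℂ) := {}
  have hL1 : 1 ≤ ℓ + 1 := Nat.succ_pos ℓ
  have hL2 : 2 ≤ ℓ + 1 := hL.2
  set S := bondsIn (loP i p) (hiP i p) with hS
  set Ash : LSite (d + 1) → Fin (d + 1) → Matrix (Fin N) (Fin N) ℂ :=
    fun z μ => ((Complex.I * ((kGeo i).eta : ℝ) : ℂ)) • a μ (transl (0 : Site (PV d ℓ i.m i.K hd hL) 0) z) with hAsh
  set Afl := insCfg S (restr S Ash) with hAfl
  have hU : ∀ μ x, U μ x ∈ unitaryUnits (Matrix (Fin N) (Fin N) ℂ) := fun μ x => hGU (mem_of_reg335P (G := G) i hreg μ x)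
  have hVu : ∀ x μ, retrP i U p x μ ∈ unitaryUnits (Matrix (Fin N) (Fin N) ℂ) := retrP_mem i hU p
  have h52 : pdev (retrP i U p) < α₀' * ((((ℓ + 1 : ℕ) : ℝ) ^ (p.1 : ℕ))⁻¹) ^ 2 := pdev_retrP_lt i hMα hK p hplaq
  -- locality: `(e^{iηa}U)♯ = e^{a♯}U♯` agrees with `e^{a♭}Û_p` on the box bonds
  have hag : AgreeOn (loP i p) (hiP i p)
      (liftCfg (P := PV d ℓ i.m i.K hd hL) (fun μ x => fluct (kGeo i).eta a μ x * U μ x)) (expCfg Afl * retrP i U p) := by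
    rw [liftCfg_mulY_fluct]
    intro x κ hx hxe
    rw [Pi.mul_apply, Pi.mul_apply, Pi.mul_apply, Pi.mul_apply, agreeOn_expCfg (agreeOn_insCfg_restr _ _ Ash) x κ hx hxe,
      agreeOn_liftCfg_retrP i U p x κ hx hxe]
  -- the gate is open at every level `< j` of the complex background
  have hβ : (0 : ℝ) ≤ α₁ * ((((ℓ + 1 : ℕ) : ℝ)) ^ (p.1 : ℕ))⁻¹ := by positivity
  have hAfl : ∀ x κ, ‖Afl x κ‖ ≤ α₁ * ((((ℓ + 1 : ℕ) : ℝ)) ^ (p.1 : ℕ))⁻¹ := norm_boxExponentP_le i p a hα₁ ha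
  have hW : ∀ n < (p.1 : ℕ), ∀ (z : LSite (d + 1)) (κ : Fin (d + 1)) (r : Fin (d + 1) → Fin (ℓ + 1)),
      ‖((Wcx (ℓ + 1) (avgIter (ℓ + 1) (expCfg Afl * retrP i U p) n) (((ℓ + 1 : ℕ) : ℤ) • z) κ (boxVec (ℓ + 1) r) :
        (Matrix (Fin N) (Fin N) ℂ)ˣ) : Matrix (Fin N) (Fin N) ℂ) - 1‖ < 1 := by
    intro n hn z κ r
    rw [avgIter_cplx_eq]
    exact level_loops_lt_one (ℓ + 1) hL2 (avgClosed_unitaryUnits (d + 1) (ℓ + 1)) (p.1 : ℕ) (retrP i U p) hVu hα' hα3 hα8 h52 Afl hβ hAfl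
      hsmall'p hc₃'p hb'1p hn _ κ r
  have hung := linCovIterC_eq_linCovIter (ℓ + 1) (expCfg Afl * retrP i U p) (liftBd i Λ) (p.1 : ℕ) hW
  rw [knitRowY, linCovIterC_congr (ℓ + 1) hL1 (p.1 : ℕ) (zSrcP i p) p.2.dir hag (fun _ _ _ _ => rfl), hung]

include hGU hMα hreg hα' hα3 hα8 hK hϱ' hϱ hsmall' hc₃' hϱ'1 hE hdX hsmall hc₃ hplaq hα₁ hα₁ϱ ha in
/-- ★★★ **[B9] (3.80)–(3.81) FOR THE KNIT ROW KERNEL AT A PAIR, ON (3.35), ROW FORM**: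
`‖knitRowY i (e^{iηa}·U) Λ p − knitRowY i U Λ p‖ ≤ (9∕(2ϱ′))·α₁·Σ_f boxKP i p f·‖Λ(f)‖` — dag-n06-l's `norm_QknitY_mulY_sub_apply_le` at the pair `p = (j, c)` with the
box's plaquette input displayed; it reads at the member's index bonds (`QknitY`) AND at the cube sequence's (`QknitCubeY`) by `rfl`.  Steps and constants = the parent's.
[cite: Balaban1985BackgroundPropagators, (3.80)–(3.81) p.406, (3.35) p.396, (3.37) p.396, p.409 l.1–5; Balaban1985Averaging, Proposition 7 p.43, (146)–(147) p.40, (141) p.39] -/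
theorem norm_knitRowY_mulY_sub_le (Λ : FBondY i → Matrix (Fin N) (Fin N) ℂ) :
    ‖knitRowY i (fun μ x => fluct (kGeo i).eta a μ x * U μ x) Λ p - knitRowY i U Λ p‖ ≤ 9 / (2 * ϱ') * α₁ * ∑ f, boxKP i p f * ‖Λ f‖ := by
  classical
  letI : CStarAlgebra (Matrix (Fin N) (Fin N) ℂ) := {}
  have hL2 : 2 ≤ ℓ + 1 := hL.2
  have hα2 : 2 * α₀' ≤ c2' (d + 1) (ℓ + 1) := by linarith
  set j : ℕ := (p.1 : ℕ) with hjdef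
  set Lj : ℝ := (((ℓ + 1 : ℕ) : ℝ)) ^ j with hLj
  have hLj0 : 0 < Lj := by positivity
  set S := bondsIn (loP i p) (hiP i p) with hS
  set Ash : LSite (d + 1) → Fin (d + 1) → Matrix (Fin N) (Fin N) ℂ :=
    fun z μ => ((Complex.I * ((kGeo i).eta : ℝ) : ℂ)) • a μ (transl (0 : Site (PV d ℓ i.m i.K hd hL) 0) z) with hAsh
  set Afl := insCfg S (restr S Ash) with hAfl
  set B := liftBd i Λ with hB
  have hU : ∀ μ x, U μ x ∈ unitaryUnits (Matrix (Fin N) (Fin N) ℂ) := fun μ x => hGU (mem_of_reg335P (G := G) i hreg μ x)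
  have hVu : ∀ x μ, retrP i U p x μ ∈ unitaryUnits (Matrix (Fin N) (Fin N) ℂ) := retrP_mem i hU p
  have h52 : pdev (retrP i U p) < α₀' * ((Lj)⁻¹) ^ 2 := pdev_retrP_lt i hMα hK p hplaq
  -- the radii in lattice units at scale `j`
  set ρ' : ℝ := ϱ' * Lj⁻¹ with hρ'
  set ρ : ℝ := ϱ * Lj⁻¹ with hρdef
  have hρ'0 : 0 < ρ' := by positivity
  have hρ0 : 0 < ρ := by positivity
  have eρ' : Lj * ρ' = ϱ' := by rw [hρ']; field_simp
  have eρ : Lj * ρ = ϱ := by rw [hρdef]; field_simp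
  have hsmall'F : Real.exp (4 * (800 * (((d + 1 : ℕ) : ℝ) + 1) ^ 2 * (((d + 1 : ℕ) : ℝ) + 4)) * α₀')
      * (1 + 8 * (131072 * (((d + 1 : ℕ) : ℝ) + 1) ^ 2) * (Lj * ρ')) ≤ 2 := by rw [eρ']; exact hsmall'
  have hc₃'F : 2 * (Lj * ρ') ≤ c3 (d + 1) (ℓ + 1) := by rw [eρ']; exact hc₃'
  have hρ'1F : 409600 * (((d + 1 : ℕ) : ℝ) + 1) ^ 2 * (Lj * ρ') ≤ 1 := by rw [eρ']; exact hϱ'1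
  obtain ⟨eE, eT⟩ := epsCplx_tauCplx_rescale (d := d) (ℓ := ℓ) α₀' ϱ' j
  have hEF : epsCplx (d + 1) (ℓ + 1) ρ' j ≤ 1 / 16 := by rw [hρ', eE]; exact hE
  have hdXF : ((d + 1 : ℕ) : ℝ) * (epsCplx (d + 1) (ℓ + 1) ρ' j + tauCplx (d + 1) (ℓ + 1) α₀' j ρ' j) ≤ 1 / 16 := by
    rw [hρ', eE, eT]; exact hdX
  have hsmallF : Real.exp (4480 * (((d + 1 : ℕ) : ℝ) + 1) ^ 2 * (((d + 1 : ℕ) : ℝ) + 4) * α₀' + 240000 * (((d + 1 : ℕ) : ℝ) + 1) ^ 3 * (Lj * ρ'))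
      * (1 + 8 * (2097152 * (((d + 1 : ℕ) : ℝ) + 1) ^ 2) * (Lj * ρ)) ≤ 2 := by rw [eρ', eρ]; exact hsmall
  have hc₃F : 2 * (Lj * ρ) ≤ c3 (d + 1) (ℓ + 1) / 4 := by rw [eρ]; exact hc₃
  -- the perturbation `a♭` has size `β = α₁L^{−j}`, `3β ≤ ρ′`
  set β : ℝ := α₁ * Lj⁻¹ with hβdef
  have hβ0 : 0 ≤ β := by positivity
  have hβρ : 3 * β ≤ ρ' := by
    rw [hβdef, hρ']
    have := mul_le_mul_of_nonneg_right hα₁ϱ (inv_pos.2 hLj0).le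
    linarith
  have hβρ' : β ≤ ρ' := by linarith
  have hAfl : ∀ x κ, ‖Afl x κ‖ ≤ β := norm_boxExponentP_le i p a hα₁ ha
  obtain ⟨hsβ, hcβ, h1β, -, -⟩ := smallness7_mono (d := d + 1) (L := ℓ + 1) (k := j) (α₀ := α₀') hβρ' le_rfl hρ0.le hsmall'F hc₃'F hρ'1F hsmallF hc₃F
  -- both rows through the retraction
  have e1 := knitRowY_mulY_apply_retract i hGU hMα hreg hα' hα3 hα8 hK p hplaq a hα₁ ha hsβ hcβ h1β Λ
  have e0 := knitRowY_apply_retract i hGU hMα hreg hα' hα3 hα8 hK p hplaq Λ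
  -- file 1 at the base `Û_p`
  have hrow := norm_linCovIter_sub_base_le_sum (ℓ + 1) hL2 (avgClosed_unitaryUnits (d + 1) (ℓ + 1)) j (retrP i U p) hVu hα' hα3 hα8 h52 hρ'0 hρ0
    hsmall'F hc₃'F hρ'1F hEF hdXF hsmallF hc₃F Afl hβ0 hAfl hβρ B le_rfl (zSrcP i p) p.2.dir
  -- the coefficient: `ϑ` is level-free and `≤ 1/2`
  have hθ : thetaCplx (d + 1) (ℓ + 1) α₀' j ρ' * (Lj * Lj⁻¹) ≤ 1 / 2 := by
    rw [mul_inv_cancel₀ hLj0.ne', mul_one, hρ', thetaCplx_rescale]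
    exact thetaCplx_le_half (d := d) (ℓ := ℓ) hα'.le hϱ'.le hdX
  have hθ0 : 0 ≤ thetaCplx (d + 1) (ℓ + 1) α₀' j ρ' * (Lj * Lj⁻¹) := mul_nonneg (thetaCplx_nonneg (d + 1) (ℓ + 1) hα'.le j hρ'0.le) (by positivity)
  -- the box mass of `Λ♯`, fibrewise
  have hmass : ∑ s ∈ bondsIn (loK (ℓ + 1) j (zSrcP i p)) (bondHiK (ℓ + 1) j (zSrcP i p) p.2.dir), ‖B s.1 s.2‖ =
      Lj ^ (d + 1) * ∑ f, boxKP i p f * ‖Λ f‖ := by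
    have h := sum_boxKP_mul_eq i p fun f => ‖Λ f‖
    rw [h, ← mul_assoc, mul_inv_cancel₀ (by positivity), one_mul, hB]
    exact Finset.sum_congr rfl fun s _ => by rw [liftBd_apply]
  have hsum0 : 0 ≤ ∑ f, boxKP i p f * ‖Λ f‖ := Finset.sum_nonneg fun f _ => mul_nonneg (boxKP_nonneg i p f) (norm_nonneg _)
  -- assemble
  rw [e1, e0, ← smul_sub, norm_smul, Complex.norm_real, Real.norm_of_nonneg (by positivity)]
  rw [hmass] at hrow
  have hdiff := hrow
  calc Lj⁻¹ * ‖linCovIter (ℓ + 1) (expCfg Afl * retrP i U p) B j (zSrcP i p) p.2.dir - linCovIter (ℓ + 1) (retrP i U p) B j (zSrcP i p) p.2.dir‖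
      ≤ Lj⁻¹ * (3 / ρ' * β * ((1 + thetaCplx (d + 1) (ℓ + 1) α₀' j ρ' * (Lj * Lj⁻¹)) * (Lj * ((Lj ^ (d + 1))⁻¹))) *
          (Lj ^ (d + 1) * ∑ f, boxKP i p f * ‖Λ f‖)) := mul_le_mul_of_nonneg_left hdiff (by positivity)
    _ ≤ Lj⁻¹ * (3 / ρ' * β * ((1 + 1 / 2) * (Lj * ((Lj ^ (d + 1))⁻¹))) * (Lj ^ (d + 1) * ∑ f, boxKP i p f * ‖Λ f‖)) := by
        have h32 : (1 + thetaCplx (d + 1) (ℓ + 1) α₀' j ρ' * (Lj * Lj⁻¹)) * (Lj * ((Lj ^ (d + 1))⁻¹)) ≤ (1 + 1 / 2) * (Lj * ((Lj ^ (d + 1))⁻¹)) :=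
          mul_le_mul_of_nonneg_right (by linarith) (by positivity)
        have hc0 : 0 ≤ 3 / ρ' * β := by positivity
        gcongr
    _ = 9 / (2 * ϱ') * α₁ * ∑ f, boxKP i p f * ‖Λ f‖ := by
        rw [hρ', hβdef]
        have hP : Lj ^ (d + 1) ≠ 0 := by positivity
        field_simp
        ring

end Main

/-! ## §4 The member face: dag-n06-l's theorem recovered (consistency check) -/

section Member

open scoped Matrix Matrix.Norms.L2Operator

variable {N : ℕ} [Nonempty (Fin N)] (i : KIdx d ℓ hd hL b₀ b₁) {G : Subgroup (Matrix (Fin N) (Fin N) ℂ)ˣ}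

/-- the member's box input: dag-n06-l's plaquette bound on the double block of a MEMBER index bond `ι` IS `hplaq` at `p = ι.1` (the member's levels at the corners).
[cite: Balaban1985BackgroundPropagators, (3.35) p.396, (3.69) p.404; Balaban1985Averaging, (52) p.26] -/
theorem hplaq_member (hG1 : ∀ u : (Matrix (Fin N) (Fin N) ℂ)ˣ, u ∈ G → ‖(u : Matrix (Fin N) (Fin N) ℂ)‖ ≤ 1)
    (U : CfgY (Matrix (Fin N) (Fin N) ℂ) i) {c₀ α₀ : ℝ} (hc : c₀ ≤ 10) (hMα : 0 ≤ (kGeo i).M * α₀)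
    (hreg : (bg9KP (Matrix (Fin N) (Fin N) ℂ) G i).Reg335 c₀ α₀ U) (ι : IBondY i) :
    ∀ (y : LSite (d + 1)), InBox (loP i ι.1) (hiP i ι.1) y → ∀ μ ν : Fin (d + 1),
      ‖((hol (readY i U) y (plaqWord μ ν) : (Matrix (Fin N) (Fin N) ℂ)ˣ) : Matrix (Fin N) (Fin N) ℂ) - 1‖ ≤
        Kpl i ((kGeo i).M * α₀) * ((kGeo i).L ^ 4 * ((((kGeo i).L ^ (ι.1.1 : ℕ))⁻¹) ^ 2)) :=
  fun _ hy μ ν => norm_hol_readY_plaqWord_sub_one_le_of_reg335P i hG1 U hc hMα hreg ι hy μ ν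

/-- ★ **dag-n06-l's (3.80)–(3.81) FOR `QknitY` RECOVERED from the pair engine** (`QknitY i U Λ ι = knitRowY i U Λ ι.1`, `boxK i ι = boxKP i ι.1`, both `rfl`; `hplaq` from
`hplaq_member`) — a consistency check of §3 against ✓`B9Eq380QknitVariationY.norm_QknitY_mulY_sub_apply_le`; nothing new.
[cite: Balaban1985BackgroundPropagators, (3.80)–(3.81) p.406, (3.35) p.396; Balaban1985Averaging, Proposition 7 p.43] -/
theorem norm_QknitY_mulY_sub_apply_le' (hG1 : ∀ u : (Matrix (Fin N) (Fin N) ℂ)ˣ, u ∈ G → ‖(u : Matrix (Fin N) (Fin N) ℂ)‖ ≤ 1)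
    (hGU : G ≤ unitaryUnits (Matrix (Fin N) (Fin N) ℂ))
    {U : CfgY (Matrix (Fin N) (Fin N) ℂ) i} {c₀ α₀ : ℝ} (hc : c₀ ≤ 10) (hMα : 0 ≤ (kGeo i).M * α₀)
    (hreg : (bg9KP (Matrix (Fin N) (Fin N) ℂ) G i).Reg335 c₀ α₀ U)
    {α₀' : ℝ} (hα' : 0 < α₀') (hα3 : C0 (d + 1) * α₀' ≤ 1 / 3) (hα8 : 8 * α₀' ≤ c2' (d + 1) (ℓ + 1))
    (hK : Kpl i ((kGeo i).M * α₀) * (kGeo i).L ^ 4 < α₀')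
    {ϱ' ϱ : ℝ} (hϱ' : 0 < ϱ') (hϱ : 0 < ϱ)
    (hsmall' : Real.exp (4 * (800 * (((d + 1 : ℕ) : ℝ) + 1) ^ 2 * (((d + 1 : ℕ) : ℝ) + 4)) * α₀')
      * (1 + 8 * (131072 * (((d + 1 : ℕ) : ℝ) + 1) ^ 2) * ϱ') ≤ 2)
    (hc₃' : 2 * ϱ' ≤ c3 (d + 1) (ℓ + 1)) (hϱ'1 : 409600 * (((d + 1 : ℕ) : ℝ) + 1) ^ 2 * ϱ' ≤ 1)
    (hE : epsCplx (d + 1) (ℓ + 1) ϱ' 0 ≤ 1 / 16)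
    (hdX : ((d + 1 : ℕ) : ℝ) * (epsCplx (d + 1) (ℓ + 1) ϱ' 0 + tauCplx (d + 1) (ℓ + 1) α₀' 0 ϱ' 0) ≤ 1 / 16)
    (hsmall : Real.exp (4480 * (((d + 1 : ℕ) : ℝ) + 1) ^ 2 * (((d + 1 : ℕ) : ℝ) + 4) * α₀' + 240000 * (((d + 1 : ℕ) : ℝ) + 1) ^ 3 * ϱ')
      * (1 + 8 * (2097152 * (((d + 1 : ℕ) : ℝ) + 1) ^ 2) * ϱ) ≤ 2)
    (hc₃ : 2 * ϱ ≤ c3 (d + 1) (ℓ + 1) / 4)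
    (a : Fin (d + 1) → Site (PV d ℓ i.m i.K hd hL) 0 → Matrix (Fin N) (Fin N) ℂ) {α₁ : ℝ} (hα₁ : 0 ≤ α₁) (hα₁ϱ : 3 * α₁ ≤ ϱ') (ι : IBondY i)
    (ha : ∀ (μ : Fin (d + 1)) (x : Site (PV d ℓ i.m i.K hd hL) 0),
      iterBlockOf (ι.1.1 : ℕ) x = ι.1.2.src ∨ iterBlockOf (ι.1.1 : ℕ) x = ι.1.2.tgt →
        (((ℓ + 1 : ℕ) : ℝ)) ^ (ι.1.1 : ℕ) * (kGeo i).eta * ‖a μ x‖ ≤ α₁)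
    (Λ : FBondY i → Matrix (Fin N) (Fin N) ℂ) :
    ‖QknitY i (fun μ x => fluct (kGeo i).eta a μ x * U μ x) Λ ι - QknitY i U Λ ι‖ ≤ 9 / (2 * ϱ') * α₁ * ∑ f, boxK i ι f * ‖Λ f‖ := by
  simp only [QknitY_apply_eq_knitRowY, boxK_eq_boxKP]
  exact norm_knitRowY_mulY_sub_le i hGU hMα hreg hα' hα3 hα8 hK hϱ' hϱ hsmall' hc₃' hϱ'1 hE hdX hsmall hc₃ ι.1 (hplaq_member i hG1 U hc hMα hreg ι)
    a hα₁ hα₁ϱ ha Λ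

end Member

/-! ## §5 The cube-sequence face: `hplaq` at the index bonds of `{Ω_n(□)}`, and (3.80)–(3.81) for `QknitCubeY i □` -/

section Cube

open scoped Matrix Matrix.Norms.L2Operator
open B7AvgPeriodicity (proj)
open B9C2LettersTorusY (T0)
open B9CubeLettersOpsL0 (cubeFamY)
open B9CubeLettersBondOpsL0 (IBondCubeY)
open B9Eq3115KnitCubeLetterY (QknitCubeY QknitCubeY_apply)
open B9Eq3124HZKnitPairReg335Y (proj_eq_transl_zero)
open B9C2FormBoxRegimeY (scale_slack hol_readY_plaqWord hol_readY_plaqWord_swap)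
open B9BackgroundsKLevelV1 (levV1)
open B9GeoLemma21KLevelV1 (one_le_k)
open B9Eq3132Ineq2142Covariant (two_le_RMh)
open B9CubeSequence408 (lev_cubeFam_le)
open B9Eq335CoveragePAtLettersY (norm_holY_sub_one_le_levelled_of_reg335P)
open B7Prop2Explicit (hol_plaqWord_self)
open B6Cover236MultiLevelBlocks (cubes)

variable {N : ℕ} [Nonempty (Fin N)] (i : KIdx d ℓ hd hL b₀ b₁) {G : Subgroup (Matrix (Fin N) (Fin N) ℂ)ˣ}

omit [Nonempty (Fin N)] in
/-- a site of the double box of the pair `p` lies (on the torus) in one of its two end blocks. [cite: Balaban1985Averaging, p.24; Balaban1984PropagatorsII, (2.3) p.224] -/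
theorem ends_of_inBox_P (p : (j : Fin (i.k + 1)) × PBond (PV d ℓ i.m i.K hd hL) (j : ℕ)) {y : LSite (d + 1)} (hy : InBox (loP i p) (hiP i p) y) :
    iterBlockOf (p.1 : ℕ) (proj (T0 i) y) = p.2.src ∨ iterBlockOf (p.1 : ℕ) (proj (T0 i) y) = p.2.tgt := by
  have hj : (p.1 : ℕ) ≤ i.m + i.K := (Nat.le_of_lt_succ p.1.2).trans i.hk
  rw [proj_eq_transl_zero, iterBlockOf_transl_zero i hj]
  rcases blk_of_inBox_bond hy with hb | hb
  · left; rw [hb, transl_zero_zSrcP]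
  · right; rw [hb, transl_add_e, transl_zero_zSrcP]; rfl

/-- ★★ **THE BOX INPUT AT AN INDEX BOND OF THE CUBE SEQUENCE**: every plaquette word of the reading with corner in the double block of a cube-sequence index bond `ι` of
level `j` is within `K_pl·L⁴·(Lʲ)⁻²` of `1` on (3.35) — the corner has CUBE level `≥ j − 1` (`lev_ends_bounds` for the cube family's domains) and the member's level
dominates the cube family's (`lev_cubeFam_le`), so dag-n06-j's levelled plaquette reading of (3.35) at the MEMBER's level applies with slack `scale_slack`.
[cite: Balaban1985BackgroundPropagators, (3.35) p.396, (3.69) p.404, p.408 (the sequence {Ω_n(□)}); Balaban1985Averaging, (52) p.26; Balaban1984PropagatorsII, (2.3)–(2.4) p.224] -/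
theorem hplaq_cube (hG1 : ∀ u : (Matrix (Fin N) (Fin N) ℂ)ˣ, u ∈ G → ‖(u : Matrix (Fin N) (Fin N) ℂ)‖ ≤ 1)
    (U : CfgY (Matrix (Fin N) (Fin N) ℂ) i) {c₀ α₀ : ℝ} (hc : c₀ ≤ 10) (hMα : 0 ≤ (kGeo i).M * α₀)
    (hreg : (bg9KP (Matrix (Fin N) (Fin N) ℂ) G i).Reg335 c₀ α₀ U) (q : ↥(cubes (toKT i).D.toDomains)) (ι : IBondCubeY i q) :
    ∀ (y : LSite (d + 1)), InBox (loP i ι.1) (hiP i ι.1) y → ∀ μ ν : Fin (d + 1),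
      ‖((hol (readY i U) y (plaqWord μ ν) : (Matrix (Fin N) (Fin N) ℂ)ˣ) : Matrix (Fin N) (Fin N) ℂ) - 1‖ ≤
        Kpl i ((kGeo i).M * α₀) * ((kGeo i).L ^ 4 * ((((kGeo i).L ^ (ι.1.1 : ℕ))⁻¹) ^ 2)) := by
  intro y hy μ ν
  have hK0 : 0 ≤ Kpl i ((kGeo i).M * α₀) := Kpl_nonneg i hMα
  have hL0 : (0 : ℝ) ≤ (kGeo i).L := by rw [show (kGeo i).L = ((ℓ + 1 : ℕ) : ℝ) from rfl]; positivity
  have hR0 : 0 ≤ Kpl i ((kGeo i).M * α₀) * ((kGeo i).L ^ 4 * ((((kGeo i).L ^ (ι.1.1 : ℕ))⁻¹) ^ 2)) := by positivity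
  -- the corner has CUBE level `≥ j − 1`, hence MEMBER level `≥ j − 1`
  have hcube := (B6Ineq2142KLevelV1L0.lev_ends_bounds i.hN (cubeFamY i q) i.hk (two_le_RMh i) ι (ends_of_inBox_P i ι.1 hy)).1
  have hlev : (ι.1.1 : ℕ) - 1 ≤ levV1 i (proj (T0 i) y) := hcube.trans (lev_cubeFam_le _)
  have hslack := scale_slack i (n := levV1 i (proj (T0 i) y)) (j := (ι.1.1 : ℕ)) hlev
  -- the levelled reading at an oriented plaquette based at the corner
  have key : ∀ {μ' ν' : Fin (d + 1)} (h : μ' < ν'),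
      ‖((Node00.holY i U ⟨proj (T0 i) y, μ', ν', h⟩ : (Matrix (Fin N) (Fin N) ℂ)ˣ) : Matrix (Fin N) (Fin N) ℂ) - 1‖ ≤
        Kpl i ((kGeo i).M * α₀) * ((kGeo i).L ^ 4 * ((((kGeo i).L ^ (ι.1.1 : ℕ))⁻¹) ^ 2)) := fun h =>
    (norm_holY_sub_one_le_levelled_of_reg335P i U hc hMα hreg ⟨proj (T0 i) y, _, _, h⟩).trans (mul_le_mul_of_nonneg_left hslack hK0)
  rcases lt_trichotomy μ ν with hlt | heq | hgt
  · rw [hol_readY_plaqWord i U y hlt]; exact key hlt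
  · subst heq; rw [hol_plaqWord_self]; simpa using hR0
  · rw [hol_readY_plaqWord_swap i U y hgt]
    have hmem : Node00.holY i U ⟨proj (T0 i) y, ν, μ, hgt⟩ ∈ G := by
      unfold Node00.holY
      have hU := mem_of_reg335P (𝔸 := Matrix (Fin N) (Fin N) ℂ) (G := G) i hreg
      exact G.mul_mem (G.mul_mem (G.mul_mem (hU _ _) (hU _ _)) (G.inv_mem (hU _ _))) (G.inv_mem (hU _ _))
    have hU1 : Node00.holY i U ⟨proj (T0 i) y, ν, μ, hgt⟩ ∈ U1 (Matrix (Fin N) (Fin N) ℂ) :=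
      ⟨hG1 _ hmem, hG1 _ (G.inv_mem hmem)⟩
    exact (B7Prop1Explicit.norm_inv_sub_one_le hU1).trans (key hgt)

/-- ★★★ **[B9] (3.80)–(3.81) FOR THE CUBE SEQUENCE's KNIT AVERAGING `QknitCubeY i □` ON (3.35), ROW FORM**: at an index bond `ι` of `{Ω_n(□)}`,
`‖(Q_□(e^{iηa}·U)Λ)(ι) − (Q_□(U)Λ)(ι)‖ ≤ (9∕(2ϱ′))·α₁·Σ_f boxKP i ι.1 f·‖Λ(f)‖` — the pair engine (§3) at `p := ι.1` (`QknitCubeY_apply`, `rfl`) with `hplaq_cube`; the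
(3.83)-shaped smallness input of the knit-pair averaging piece of dag-n06-j's ✓`B9Cor35GDirAtKnitCubeLetters` (HAND (s3-b)).
[cite: Balaban1985BackgroundPropagators, (3.80)–(3.83) pp.406–407, (3.35) p.396, p.409 l.1–5; Balaban1985Averaging, Proposition 7 p.43, (141) p.39] -/
theorem norm_QknitCubeY_mulY_sub_apply_le (hG1 : ∀ u : (Matrix (Fin N) (Fin N) ℂ)ˣ, u ∈ G → ‖(u : Matrix (Fin N) (Fin N) ℂ)‖ ≤ 1)
    (hGU : G ≤ unitaryUnits (Matrix (Fin N) (Fin N) ℂ))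
    {U : CfgY (Matrix (Fin N) (Fin N) ℂ) i} {c₀ α₀ : ℝ} (hc : c₀ ≤ 10) (hMα : 0 ≤ (kGeo i).M * α₀)
    (hreg : (bg9KP (Matrix (Fin N) (Fin N) ℂ) G i).Reg335 c₀ α₀ U)
    {α₀' : ℝ} (hα' : 0 < α₀') (hα3 : C0 (d + 1) * α₀' ≤ 1 / 3) (hα8 : 8 * α₀' ≤ c2' (d + 1) (ℓ + 1))
    (hK : Kpl i ((kGeo i).M * α₀) * (kGeo i).L ^ 4 < α₀')
    {ϱ' ϱ : ℝ} (hϱ' : 0 < ϱ') (hϱ : 0 < ϱ)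
    (hsmall' : Real.exp (4 * (800 * (((d + 1 : ℕ) : ℝ) + 1) ^ 2 * (((d + 1 : ℕ) : ℝ) + 4)) * α₀')
      * (1 + 8 * (131072 * (((d + 1 : ℕ) : ℝ) + 1) ^ 2) * ϱ') ≤ 2)
    (hc₃' : 2 * ϱ' ≤ c3 (d + 1) (ℓ + 1)) (hϱ'1 : 409600 * (((d + 1 : ℕ) : ℝ) + 1) ^ 2 * ϱ' ≤ 1)
    (hE : epsCplx (d + 1) (ℓ + 1) ϱ' 0 ≤ 1 / 16)
    (hdX : ((d + 1 : ℕ) : ℝ) * (epsCplx (d + 1) (ℓ + 1) ϱ' 0 + tauCplx (d + 1) (ℓ + 1) α₀' 0 ϱ' 0) ≤ 1 / 16)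
    (hsmall : Real.exp (4480 * (((d + 1 : ℕ) : ℝ) + 1) ^ 2 * (((d + 1 : ℕ) : ℝ) + 4) * α₀' + 240000 * (((d + 1 : ℕ) : ℝ) + 1) ^ 3 * ϱ')
      * (1 + 8 * (2097152 * (((d + 1 : ℕ) : ℝ) + 1) ^ 2) * ϱ) ≤ 2)
    (hc₃ : 2 * ϱ ≤ c3 (d + 1) (ℓ + 1) / 4)
    (a : Fin (d + 1) → Site (PV d ℓ i.m i.K hd hL) 0 → Matrix (Fin N) (Fin N) ℂ) {α₁ : ℝ} (hα₁ : 0 ≤ α₁) (hα₁ϱ : 3 * α₁ ≤ ϱ')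
    (q : ↥(cubes (toKT i).D.toDomains)) (ι : IBondCubeY i q)
    (ha : ∀ (μ : Fin (d + 1)) (x : Site (PV d ℓ i.m i.K hd hL) 0),
      iterBlockOf (ι.1.1 : ℕ) x = ι.1.2.src ∨ iterBlockOf (ι.1.1 : ℕ) x = ι.1.2.tgt →
        (((ℓ + 1 : ℕ) : ℝ)) ^ (ι.1.1 : ℕ) * (kGeo i).eta * ‖a μ x‖ ≤ α₁)
    (Λ : FBondY i → Matrix (Fin N) (Fin N) ℂ) :
    ‖QknitCubeY i q (fun μ x => fluct (kGeo i).eta a μ x * U μ x) Λ ι - QknitCubeY i q U Λ ι‖ ≤ 9 / (2 * ϱ') * α₁ * ∑ f, boxKP i ι.1 f * ‖Λ f‖ := by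
  simp only [QknitCubeY_apply]
  exact norm_knitRowY_mulY_sub_le i hGU hMα hreg hα' hα3 hα8 hK hϱ' hϱ hsmall' hc₃' hϱ'1 hE hdX hsmall hc₃ ι.1 (hplaq_cube i hG1 U hc hMα hreg q ι)
    a hα₁ hα₁ϱ ha Λ

end Cube

/-! ## §6 (v1.1) The end-block law `ha` at a cube-sequence index bond from r06's nested class (3.37): the level window (cube twin of dag-n06-l's `endBlock_small_of_cplx337`) -/

section WindowCube

open B9BackgroundsKLevelV1 (levV1 shiftsV1)
open B9Eq335RegularityClasses (Cplx337 OnOmega)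
open LatticeNorms (scaleLen)
open B9GeoLemma21KLevelV1 (geo9K_eta_pos)
open B9Eq3132Ineq2142Covariant (two_le_RMh)
open B9CubeSequence408 (lev_cubeFam_le)
open B9CubeLettersOpsL0 (cubeFamY)
open B9CubeLettersBondOpsL0 (IBondCubeY)
open B6Cover236MultiLevelBlocks (cubes)

variable {𝔸 : Type} [NormedRing 𝔸] [NormedAlgebra ℂ 𝔸] [CompleteSpace 𝔸]

/-- ★ **THE LEVEL WINDOW AT A CUBE-SEQUENCE INDEX BOND — the `ha` input of `norm_QknitCubeY_mulY_sub_apply_le` FROM r06's NESTED CLASS (3.37) WITH `cA = L`**: if `a` lies in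
`Cplx337 … (levV1 i) α₁` («|A′| < α₁(Lʲη)⁻¹ on Ω_j» at the MEMBER's levels), then on the two end blocks of every index bond `κ` of the cube sequence `{Ω_n(□)}` of level `j` —
whose fine sites have CUBE level `≥ j − 1` (`B6Ineq2142KLevelV1L0.lev_ends_bounds` at `cubeFamY i □`) hence MEMBER level `≥ j − 1` (`lev_cubeFam_le`) — `Lʲη·‖a_μ(x)‖ ≤ L·α₁`
(dag-n06-l's `B9SectBQVarLawsOfKernelY.endBlock_small_of_cplx337` verbatim with the two-step level comparison).
[cite: Balaban1985BackgroundPropagators, (3.37) p.396, p.406 (before (3.79)), p.408 (the sequence {Ω_n(□)}); Balaban1984PropagatorsII, (2.2)–(2.4) p.224] -/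
theorem endBlock_small_of_cplx337_cube (i : KIdx d ℓ hd hL b₀ b₁) {U : CfgY 𝔸 i} {α₁ : ℝ} {a : Fin (d + 1) → Site (PV d ℓ i.m i.K hd hL) 0 → 𝔸}
    (h37 : Cplx337 (shiftsV1 (PV d ℓ i.m i.K hd hL)) U (kGeo i).eta (kGeo i).L (levV1 i) α₁ a)
    (q : ↥(cubes (toKT i).D.toDomains)) (κ : IBondCubeY i q) (μ : Fin (d + 1)) (x : Site (PV d ℓ i.m i.K hd hL) 0)
    (hx : iterBlockOf (κ.1.1 : ℕ) x = κ.1.2.src ∨ iterBlockOf (κ.1.1 : ℕ) x = κ.1.2.tgt) :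
    (((ℓ + 1 : ℕ) : ℝ)) ^ (κ.1.1 : ℕ) * (kGeo i).eta * ‖a μ x‖ ≤ (((ℓ + 1 : ℕ) : ℝ)) * α₁ := by
  have hη : 0 < (kGeo i).eta := geo9K_eta_pos i
  have hL1 : (1 : ℝ) ≤ (((ℓ + 1 : ℕ) : ℝ)) := by exact_mod_cast Nat.succ_le_succ (Nat.zero_le ℓ)
  have hL0 : (0 : ℝ) < (((ℓ + 1 : ℕ) : ℝ)) := by positivity
  set j : ℕ := (κ.1.1 : ℕ) with hj
  -- the site lies in `Ω_{j−1}`: cube level `≥ j − 1`, member level `≥` cube level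
  have hlev : j - 1 ≤ levV1 i x :=
    (B6Ineq2142KLevelV1L0.lev_ends_bounds i.hN (cubeFamY i q) i.hk (two_le_RMh i) κ hx).1.trans (lev_cubeFam_le _)
  have hOm : OnOmega (levV1 i) (j - 1) x := hlev
  have hb := h37.1 (j - 1) μ x hOm
  have hsc : scaleLen (kGeo i).L (kGeo i).eta (j - 1) = (((ℓ + 1 : ℕ) : ℝ)) ^ (j - 1) * (kGeo i).eta := rfl
  rw [hsc] at hb
  have hpos : 0 < (((ℓ + 1 : ℕ) : ℝ)) ^ (j - 1) * (kGeo i).eta := by positivity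
  have hb' : (((ℓ + 1 : ℕ) : ℝ)) ^ (j - 1) * (kGeo i).eta * ‖a μ x‖ ≤ α₁ := by
    have := (lt_mul_inv_iff₀ hpos).1 hb
    nlinarith [this]
  have hpow : (((ℓ + 1 : ℕ) : ℝ)) ^ j ≤ (((ℓ + 1 : ℕ) : ℝ)) * (((ℓ + 1 : ℕ) : ℝ)) ^ (j - 1) := by
    rcases Nat.eq_zero_or_pos j with h0 | hp
    · rw [h0, pow_zero]; simp
    · rw [← pow_succ', Nat.sub_add_cancel hp]
  calc (((ℓ + 1 : ℕ) : ℝ)) ^ j * (kGeo i).eta * ‖a μ x‖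
      ≤ ((((ℓ + 1 : ℕ) : ℝ)) * (((ℓ + 1 : ℕ) : ℝ)) ^ (j - 1)) * (kGeo i).eta * ‖a μ x‖ := by gcongr
    _ = (((ℓ + 1 : ℕ) : ℝ)) * ((((ℓ + 1 : ℕ) : ℝ)) ^ (j - 1) * (kGeo i).eta * ‖a μ x‖) := by ring
    _ ≤ (((ℓ + 1 : ℕ) : ℝ)) * α₁ := mul_le_mul_of_nonneg_left hb' hL0.le

end WindowCube

end Literature.MathematicalPhysics.QuantumFieldTheory.Balaban1983to89.B9Eq380KnitRowVariationY

end
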